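import Summits.ResolutionOfSingularities.ResolutionOfSingularities.Theorems.HilbertSamuelEliminationSigmaMaxModificationsCorridor3WLadderSegmentsExtract
import HarnessLib

/-!
# [OURS · L1 W4.2] THE UNITS-HALF EXTRACTION, CHARACTERISTIC-FREE FORM (for the `p = 2` row: model (b) without the (F1) conjunct)
# (crux `SigmaMaxModifications` stmt-ResolutionOfSingularities-18506; conjunct `SigmaMaxModificationsCorridor3` stmt-…-19249; line `w_ladder` v6;
# plan-1 RULINGS v3.11 (2)(b) «ONE extraction serves the char row and the p = 2 row iff U-seg lands in the Loc form»)

Stub worker res-L1-w42-stub-1 (gen 3). Helper file `--supports stmt-ResolutionOfSingularities-19249 --as helper`; kernel only, no named fact, no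
new definition. The extraction of `…Corridor3WLadderSegmentsExtract` with the (F1) conjunct `CharHypothesis` DROPPED from hypotheses and conclusion,
over an ARBITRARY origin predicate `Q`: `Seg.exists_localizedChain_free` and the origin-predicate form
`Moving.unitTowerExtractionLocFree_of_recognition : Seg.UnitRecognitionAtQM p Q → (binders of UnitTowerExtractionLocAtQM p Q) →
∃ T len pt tpt, IsLocalizedChainOfFundamentalUnits T 3 len pt tpt ∧ KeySetting (T 0) 3 ∧ ∀ i, IsIsolatedInHSMaxLocus ((T i).X 0) 3 (pt i)` —
the antecedent shape of a characteristic-free unit-wise localised Key Theorem 6.40 (the `p = 2`, `dim X = 3` row, where (F1) reads `5 ≤ 4`).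

OURS bookkeeping; NOT a statement of the manuscript [Hironaka2017] nor of [CossartJannsenSaito2020]. AI-written; AI review is weaker than
expert review.

References: V. Cossart, U. Jannsen, S. Saito, LNM 2270 (2020), Def. 6.38, Def. 6.39, Thm. 6.40, p. 107 [CossartJannsenSaito2020].
-/

noncomputable section

set_option linter.dupNamespace false -- namespace `…Corridor3.Moving` re-enters `…Corridor3` (module convention of the Moving files)

open CategoryTheory AlgebraicGeometry TopologicalSpace Topology IsLocalRing
open Literature.AlgebraicGeometry.Resolution Literature.RingTheory.HilbertSamuel
open Literature.AlgebraicGeometry.CossartJannsenSaito2020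
open Summit.ResolutionOfSingularities.ResolutionOfSingularities.Theorems.CampaignW42
open Summit.ResolutionOfSingularities.ResolutionOfSingularities.Theorems.SigmaMaxModificationsCorridor3.Helpers

namespace Summit.ResolutionOfSingularities.ResolutionOfSingularities.Theorems.SigmaMaxModificationsCorridor3.Moving

namespace Seg

section Extraction

variable {R : ∀ S : Scheme.{0}, CentreSeq S → Prop} {N : ℕ} {ν : ℕ → ℕ} {k : Type} [Field k]
  {c : ℕ → MarkedStage.{0}} (hc : ∀ n, CanonicalNearStep R N ν (c n) (c (n + 1))) (hRf : OracleFunctional R) (hRa : OracleAdmissible R)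
  (hν : ν ≠ iterPSum N Phi) (h0 : Helpers.CycleInv k N ν (c 0)) (hgen : ∀ n, ∃ m, n ≤ m ∧ (c m).IsBlownUp R N ν)
  (hBG : ∀ n, ∃ m, n ≤ m ∧ (c m).IsBlownUp R N ν ∧ Iso N (c m))
  {p : ℕ} {X : Scheme.{0}} [IsLocallyNoetherian X] {x : X} (hX : IsMaximalOrigin p N ν X x)
  (hreach : Reaches R N ν (MarkedStage.init X x) (c 0)) (h22 : ∀ n, Iso N (c n) → dirDim (c n) = 2 ∧ (c n).geomDirDim = 2)

include hRf hX hreach h22 in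
/-- **THE UNITS-HALF EXTRACTION WITHOUT (F1)**: as `Seg.exists_localizedChain`, with the `CharHypothesis` hypothesis and conjunct dropped.
[cite: CossartJannsenSaito2020, Def. 6.38, Def. 6.39, p. 107] -/
theorem exists_localizedChain_free
    (hemp : ∀ b, (c b).IsBlownUp R N ν → Iso N (c b) → HEmp hc hRa hν h0 b)
    (hdisc : ∀ b (hb : (c b).IsBlownUp R N ν) (hiso : Iso N (c b)),
      UnitCentreDiscipline (unitTower hc hRa hν h0 hgen b (hemp b hb hiso)) N (unitLen hgen hBG b) (basePt hc hRa hν h0 b)) :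
    ∃ (T : ℕ → BlowupTower.{0}) (len : ℕ → ℕ) (pt : ∀ i, (T i).X 0) (tpt : ∀ i, (T i).X (len i)),
      IsLocalizedChainOfFundamentalUnits T N len pt tpt ∧ KeySetting (T 0) N ∧
      ∀ i, @IsIsolatedInHSMaxLocus ((T i).X 0) ((T i).ln 0) N (pt i) := by
  have hB : ∀ i, (c (segBase hgen hBG i)).IsBlownUp R N ν := Seg.B_segBase hgen hBG
  have hG : ∀ i, Iso N (c (segBase hgen hBG i)) := Seg.G_segBase hgen hBG
  refine ⟨fun i => unitTower hc hRa hν h0 hgen (segBase hgen hBG i) (hemp _ (hB i) (hG i)), fun i => unitLen hgen hBG (segBase hgen hBG i),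
    fun i => basePt hc hRa hν h0 (segBase hgen hBG i), fun i => termPt hc hRa hν h0 hgen hBG (segBase hgen hBG i) (hemp _ (hB i) (hG i)),
    ⟨?_, ?_, ?_⟩, ?_, ?_⟩
  · exact isLocalAt_unitTower hc hRa hν h0 hgen (segBase hgen hBG 0) _
  · exact fun i => isFundamentalUnit_unitTower hc hRf hRa hν h0 hgen hBG hX hreach h22 (segBase hgen hBG i) (hB i) (hG i) _ (hdisc _ (hB i) (hG i))
  · exact fun i => isLocalSchemeAt_unitTower_terminal hc hRa hν h0 hgen hBG (segBase hgen hBG i) _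
  · exact keySetting_unitTower hc hRa hν h0 hgen (segBase hgen hBG 0) _
  · intro i
    have hcyc : Helpers.CycleInv k N ν (c (segBase hgen hBG i)) := cycleInv_at hc hRa hν h0 _
    refine isIsolatedInHSMaxLocus_unitTower hc hRa hν h0 hgen (segBase hgen hBG i) _
      (fun y hy => hsFun_le_of_specializes_of_cycleInv hcyc hy) ?_
    rw [hsFun_pt hc hX hreach]
    exact stratumIsolated_at hc hRa hν hX hreach _ (hG i)

end Extraction

end Seg

/-- **THE UNITS-HALF EXTRACTION OVER ANY ORIGIN PREDICATE `Q`, CHARACTERISTIC-FREE, MODULO RECOGNITION** — the binders of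
`UnitTowerExtractionLocAtQM p Q`, conclusion without `CharHypothesis` (for the `p = 2`, `dim X = 3` row, to be met by a characteristic-free
unit-wise localised Thm. 6.40). [cite: CossartJannsenSaito2020, Def. 6.38, Def. 6.39, Thm. 6.40, p. 107] -/
theorem unitTowerExtractionLocFree_of_recognition (p : ℕ) (Q : ℕ → (ℕ → ℕ) → ∀ X : Scheme.{0}, X → Prop)
    (hrec : Seg.UnitRecognitionAtQM p Q) :
    ∀ (R : ∀ S : Scheme.{0}, CentreSeq S → Prop), OracleFunctional R → OracleAdmissible R →
    ∀ (ν : ℕ → ℕ) (X : Scheme.{0}) [IsLocallyNoetherian X] (x : X), IsMaximalOrigin p 3 ν X x → Q 3 ν X x →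
    ∀ c : ℕ → MarkedStage.{0}, Reaches R 3 ν (MarkedStage.init X x) (c 0) →
      (∀ n, CanonicalNearStep R 3 ν (c n) (c (n + 1))) → (∀ n, (c n).geomDirDim ≤ 2) →
      (∀ n, ∃ m, n ≤ m ∧ (c m).IsBlownUp R 3 ν) → (∀ n, ∃ m, n ≤ m ∧ Iso 3 (c m)) →
      (∀ n, Iso 3 (c n) → dirDim (c n) = 2 ∧ (c n).geomDirDim = 2) →
      ∃ (T : ℕ → BlowupTower.{0}) (len : ℕ → ℕ) (pt : ∀ i, (T i).X 0) (tpt : ∀ i, (T i).X (len i)),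
        IsLocalizedChainOfFundamentalUnits T 3 len pt tpt ∧ KeySetting (T 0) 3 ∧
        ∀ i, @IsIsolatedInHSMaxLocus ((T i).X 0) ((T i).ln 0) 3 (pt i) := by
  intro R hRf hRa ν X _ x hX hq c hreach hc hē hgen hIso h22
  have hν : ν ≠ iterPSum 3 Phi := by
    intro hν
    obtain ⟨m, -, hm⟩ := hgen 0
    exact hX.not_isBlownUp_of_eq_iterPSum hRf hRa hν (reaches_chain hreach hc m) (hc m) hm
  obtain ⟨k, _, hcyc⟩ := Helpers.CycleInv.init (N := 3) (ν := ν) hX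
  have h0 : Helpers.CycleInv k 3 ν (c 0) := hcyc.of_reaches hRa hν hreach
  have hBG := Seg.exists_isBlownUp_and_iso hRa hν hX hreach hc hgen hIso
  have hrec' := hrec R hRf hRa ν X x hX hq c hreach hc hē hgen hIso h22 k inferInstance h0 hν hBG
  exact Seg.exists_localizedChain_free hc hRf hRa hν h0 hgen hBG hX hreach h22 (fun b hb hiso => (hrec' b hb hiso).choose)
    fun b hb hiso => (hrec' b hb hiso).choose_spec

/-- The (F1)-form recovered: over `Q` with (F1) ALONG the chain at the bases (e.g. `QCharRegime p`), the characteristic-free extraction plus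
`CharHypothesis` at the first base give `UnitTowerExtractionLocAtQM p Q` — so ONE recognition statement serves every origin predicate.
[cite: CossartJannsenSaito2020, Thm. 10.2, Def. 6.39] -/
theorem unitTowerExtractionLocAtQM_of_recognition (p : ℕ) (Q : ℕ → (ℕ → ℕ) → ∀ X : Scheme.{0}, X → Prop)
    (hQ : ∀ (R : ∀ S : Scheme.{0}, CentreSeq S → Prop) (ν : ℕ → ℕ) (X : Scheme.{0}) [IsLocallyNoetherian X] (x : X),
      IsMaximalOrigin p 3 ν X x → Q 3 ν X x → ∀ s : MarkedStage.{0}, Reaches R 3 ν (MarkedStage.init X x) s → CharHypothesis s.W s.pt)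
    (hrec : Seg.UnitRecognitionAtQM p Q) : UnitTowerExtractionLocAtQM p Q := by
  intro R hRf hRa ν X _ x hX hq c hreach hc hē hgen hIso h22
  have hν : ν ≠ iterPSum 3 Phi := by
    intro hν
    obtain ⟨m, -, hm⟩ := hgen 0
    exact hX.not_isBlownUp_of_eq_iterPSum hRf hRa hν (reaches_chain hreach hc m) (hc m) hm
  obtain ⟨k, _, hcyc⟩ := Helpers.CycleInv.init (N := 3) (ν := ν) hX
  have h0 : Helpers.CycleInv k 3 ν (c 0) := hcyc.of_reaches hRa hν hreach
  have hBG := Seg.exists_isBlownUp_and_iso hRa hν hX hreach hc hgen hIso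
  have hrec' := hrec R hRf hRa ν X x hX hq c hreach hc hē hgen hIso h22 k inferInstance h0 hν hBG
  exact Seg.exists_localizedChain hc hRf hRa hν h0 hgen hBG hX hreach h22 (fun b hb hiso => (hrec' b hb hiso).choose)
    (fun b hb hiso => (hrec' b hb hiso).choose_spec) (fun n => hQ R ν X x hX hq (c n) (reaches_chain hreach hc n))

end Summit.ResolutionOfSingularities.ResolutionOfSingularities.Theorems.SigmaMaxModificationsCorridor3.Moving

end
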